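import Literature.MathematicalPhysics.QuantumLattice.FermiRG.FKTLaddersResectorizationCore

/-!
# Feldman–Knörrer–Trubowitz, *Particle–Hole Ladders*: the Fourier-support step of Lemma II.16

Theorem-only companion of the typer file `FKTLaddersSec1.lean` (F7a, frozen; nothing there is edited)
for the cell `gate-hubbard-kl` (seat hubbard-kl-t10; dag g6 re-point item (3)(ii), 2026-08-26): the
SUPPORT step of the proof of Lemma II.16 (`\lemLADresectornorm`; tree: the named fact
`FKTLadders.ResectorizationNormBound`, licence F-075) of J. Feldman, H. Knörrer, E. Trubowitz,
*Particle–Hole Ladders*, Commun. Math. Phys. **247** (2004) 179–194, arXiv:math-ph/0209044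
[FeldmanKnorrerTrubowitz2004Ladders].  Locators `p.N Ln` = chunk `pNNNN.txt` line `n` of the
materialised arXiv TeX, as in F7a.  The geometric half ("at most 3 per leg") is the sibling companion
`FKTLaddersSectorCounting.lean`.

THE PRINTED STEP (p.13 L48–53): "for any fixed `s₁,…,s₄`, there are at most `3⁴` choices of
`(s'₁,…,s'₄)` for which the integral `∫ ∏_ν (dx'_ν χ̂_{s_ν}((-1)^{b_ν}(x_ν-x'_ν))) f((x'₁,s'₁),…)`
fails to vanish identically, because `f` is sectorized".  The content formalised here is the
vanishing: in Fourier space the convolution with `χ̂_{s_ν}` in the position leg `ν` multiplies the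
total Fourier transform `f̌` (Definition I.5 (ii)) by `χ_{s_ν}(k_ν)`, supported in the extended sector
`s̃_ν` of the NEW scale (`LadderData.Admissible.chi_support`), while `f̌(…, (k_ν, s'_ν), …)` vanishes
unless `k_ν ∈ s̃'_ν` (Definition I.6, `IsSectorized`, stated on the momentum-conservation surface
`k 0 - k 1 - k 2 + k 3 = 0`, rev. 3); so if `s̃_ν ∩ s̃'_ν = ∅` for ONE leg `ν` the resectorisation
integrand integrates to zero for every choice of the outer positions.

## Statement proved (`integral_resect_eq_zero_of_extSector_disjoint`)

For admissible ladder data, the all-position component (`∀ μ, i μ = 1`) of a function `f` that is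
sectorized at the old scales `(jl, jr)` and translation invariant, new labels `s μ ∈ Σ_{new μ}` (new
scales `jl', jr' ≥ 1`), old labels `s'`, and a leg `ν` with
`extSector (new ν) (s ν) ∩ extSector (old ν) (s' ν) = ∅`: for every `y`,
`∫ x', (∏_μ χ̂_{s_μ}((-1)^{b_μ} • (y μ - x' μ))) · f i x' s' = 0`, the integral being LITERALLY the
summand of `resectFour D jl jr jl' jr' f i y s` (Definition I.18: the product runs over the subtype
`{μ // chg μ}` for any decidable `chg` with `∀ μ, chg μ`).  HYPOTHESIS beyond print: leg-integrability
of the pinned sections `u ↦ f i (pin_π u) s'` for every leg `π` (the shape of the `L¹–L^∞` norm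
`l1linfLegs`, Definition I.10, with the sup-leg pinned at `0`) — without it the statement is FALSE as
typed: for a bounded non-integrable translation-invariant `f` the tree's `totalFT` is the Bochner junk
value `0`, so `f` counts as sectorized for every label, while its `χ̂`-convolution need not vanish.  In
the Lemma II.16 line this hypothesis is exactly "the right-hand side norm is finite" (if it is `⊤` the
printed inequality is trivial).

## Proof route (ours; the paper says "because f is sectorized")

No Fourier inversion is used (Mathlib's inversion theorem needs continuity of `χ_s`, which the data
do not provide).  Instead:
* §0 algebra of the pairing `⟨k,x⟩_-` (`mink`) and of the leg phases; on the conservation surface the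
  full phase `∏_μ e^{i(-1)^{b_μ}⟨k_μ,x_μ⟩_-}` is invariant under a common translation of the `x_μ`;
* §1 a generic measure-preserving "insert one coordinate" equivalence
  `X × (κ' → X) ≃ᵐ (κ → X)` (proved on boxes with `Measure.pi_eq`), used to split off one position
  variable; §2 Haar-type invariances of the volumes involved;
* §3 (Fubini) for integrable `G` on `(κ → ℝ³)` and integrable `χ_j`:
  `∫ (∏_j χ̂_j(σ_j • (w_j - u_j))) G(u) du = c ∫ (∏_j χ_j(q_j)) e^{-i Σ σ_j⟨q_j,w_j⟩} Ĝ_σ(q) dq`, so the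
  left side vanishes as soon as `(∏_j χ_j(q_j)) Ĝ_σ(q) = 0` for all `q` (`Ĝ_σ` the phase transform
  with the same signs) — `integral_prod_chiHat_mul_eq_zero`;
* §4 the tree's `totalFT` pins the position leg `Classical.choose _`; RE-PINNING: on the conservation
  surface the pinned transform does not depend on the pinned leg (translation invariance + §1 + Fubini),
  so `IsSectorized` controls the transform pinned at ANY leg — `pinFT_eq_pinFT`,
  `pinFT_eq_zero_of_not_mem_extSector`;
* §5 assembly: split off the position of a leg `π ≠ ν`, translate it away, apply §3 on the remaining
  legs with `Ĝ` = the transform pinned at `π`, which vanishes by §4 whenever `χ_{s_ν}(q_ν) ≠ 0`.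

Theorem-only: no `def`, no named fact, no `instance`, no `notation`; nothing about the Hubbard model is
asserted.
-/

noncomputable section

open MeasureTheory Set

namespace Literature.MathematicalPhysics.QuantumLattice.FermiRG

namespace FKTLadders

/-! ### §0 Algebra of the pairing and of the leg phases -/

/-- `⟨k, x⟩_-` is additive in `x`. [cite: FeldmanKnorrerTrubowitz2004Ladders, Definition I.4 (p.5 L61)] -/
theorem mink_add_right (k x y : SpT) : mink k (x + y) = mink k x + mink k y := by
  simp only [mink, Prod.fst_add, Prod.snd_add, Pi.add_apply]; ring

/-- `⟨k, x⟩_-` is additive in `k`. [cite: FeldmanKnorrerTrubowitz2004Ladders, Definition I.4 (p.5 L61)] -/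
theorem mink_add_left (k k' x : SpT) : mink (k + k') x = mink k x + mink k' x := by
  simp only [mink, Prod.fst_add, Prod.snd_add, Pi.add_apply]; ring

/-- `⟨k, -x⟩_- = -⟨k, x⟩_-`. [cite: FeldmanKnorrerTrubowitz2004Ladders, Definition I.4 (p.5 L61)] -/
theorem mink_neg_right (k x : SpT) : mink k (-x) = -mink k x := by
  simp only [mink, Prod.fst_neg, Prod.snd_neg, Pi.neg_apply]; ring

/-- `⟨k, x - y⟩_- = ⟨k, x⟩_- - ⟨k, y⟩_-`. [cite: FeldmanKnorrerTrubowitz2004Ladders, Definition I.4 (p.5 L61)] -/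
theorem mink_sub_right (k x y : SpT) : mink k (x - y) = mink k x - mink k y := by
  rw [sub_eq_add_neg, mink_add_right, mink_neg_right, sub_eq_add_neg]

/-- `⟨k, c • x⟩_- = c ⟨k, x⟩_-`. [cite: FeldmanKnorrerTrubowitz2004Ladders, Definition I.4 (p.5 L61)] -/
theorem mink_smul_right (k x : SpT) (c : ℝ) : mink k (c • x) = c * mink k x := by
  simp only [mink, Prod.smul_fst, Prod.smul_snd, Pi.smul_apply, smul_eq_mul]; ring

/-- `⟨c • k, x⟩_- = c ⟨k, x⟩_-`. [cite: FeldmanKnorrerTrubowitz2004Ladders, Definition I.4 (p.5 L61)] -/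
theorem mink_smul_left (k x : SpT) (c : ℝ) : mink (c • k) x = c * mink k x := by
  simp only [mink, Prod.smul_fst, Prod.smul_snd, Pi.smul_apply, smul_eq_mul]; ring

/-- `⟨k, 0⟩_- = 0`. [cite: FeldmanKnorrerTrubowitz2004Ladders, Definition I.4 (p.5 L61)] -/
theorem mink_zero_right (k : SpT) : mink k 0 = 0 := by
  simp [mink]

/-- `⟨0, x⟩_- = 0`. [cite: FeldmanKnorrerTrubowitz2004Ladders, Definition I.4 (p.5 L61)] -/
theorem mink_zero_left (x : SpT) : mink 0 x = 0 := by
  simp [mink]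

/-- `⟨Σ_i k_i, x⟩_- = Σ_i ⟨k_i, x⟩_-`. [cite: FeldmanKnorrerTrubowitz2004Ladders, Definition I.4 (p.5 L61)] -/
theorem mink_sum_left {ι : Type*} (s : Finset ι) (k : ι → SpT) (x : SpT) :
    mink (∑ i ∈ s, k i) x = ∑ i ∈ s, mink (k i) x := by
  classical
  induction s using Finset.induction_on with
  | empty => simp [mink_zero_left]
  | insert a s ha ih => rw [Finset.sum_insert ha, Finset.sum_insert ha, mink_add_left, ih]

/-- The pairing composed with continuous maps is continuous (`fun_prop` form of the companion's
`continuous_mink`).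
[cite: FeldmanKnorrerTrubowitz2004Ladders, Definition I.4 (p.5 L61)] -/
@[fun_prop]
theorem continuous_mink_comp {α : Type*} [TopologicalSpace α] {f g : α → SpT} (hf : Continuous f)
    (hg : Continuous g) : Continuous fun a => mink (f a) (g a) :=
  continuous_mink.comp (hf.prodMk hg)

/-- The signed sum of (I.4): `Σ_μ (-1)^{b_μ} k_μ = k₁ - k₂ - k₃ + k₄` (legs `0,…,3`).
[cite: FeldmanKnorrerTrubowitz2004Ladders, (I.4) (p.5 L56–64) and Definition I.5 (ii) (p.5 L95–108)] -/
theorem sum_neg_one_pow_bExp_smul (k : Fin 4 → SpT) :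
    ∑ μ : Fin 4, ((-1 : ℝ) ^ bExp μ) • k μ = k 0 - k 1 - k 2 + k 3 := by
  have h0 : bExp 0 = 0 := by simp [bExp]
  have h1 : bExp 1 = 1 := by simp [bExp]
  have h2 : bExp 2 = 1 := by simp [bExp]
  have h3 : bExp 3 = 0 := by simp [bExp]
  simp only [Fin.sum_univ_four, h0, h1, h2, h3, pow_zero, pow_one, one_smul, neg_one_smul]
  abel

/-- `(-1)^{b_μ} (-1)^{b_μ} = 1`. [cite: FeldmanKnorrerTrubowitz2004Ladders, (I.4) (p.5 L56–64)] -/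
theorem neg_one_pow_bExp_mul_self (μ : Fin 4) : ((-1 : ℝ) ^ bExp μ) * ((-1 : ℝ) ^ bExp μ) = 1 := by
  rw [← pow_add, ← two_mul, pow_mul]; norm_num

/-- The leg phase at position `0` is `1`. [cite: FeldmanKnorrerTrubowitz2004Ladders, Definition I.4 (ii) (p.5 L52–55)] -/
theorem legPhase_zero_right (μ : Fin 4) (k : SpT) : legPhase μ k 0 = 1 := by
  simp [legPhase, mink_zero_right]

/-- The leg phase has norm one. [cite: FeldmanKnorrerTrubowitz2004Ladders, Definition I.4 (ii) (p.5 L52–55)] -/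
theorem norm_legPhase (μ : Fin 4) (k x : SpT) : ‖legPhase μ k x‖ = 1 := by
  rw [legPhase, Complex.norm_exp]
  simp [Complex.mul_re, Complex.I_re, Complex.I_im]
  rcases neg_one_pow_eq_or ℂ (bExp μ) with h | h <;> simp [h]

/-- The leg phase of a translated position: `e_μ(k, x + t) = e_μ(k, x) e_μ(k, t)`.
[cite: FeldmanKnorrerTrubowitz2004Ladders, Definition I.4 (ii) (p.5 L52–55)] -/
theorem legPhase_add_right (μ : Fin 4) (k x t : SpT) :
    legPhase μ k (x + t) = legPhase μ k x * legPhase μ k t := by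
  simp only [legPhase, mink_add_right, Complex.ofReal_add, ← Complex.exp_add]
  ring_nf

/-- The product of the leg phases of a COMMON translation `t` over all four legs is the phase of the
signed total momentum: `∏_μ e_μ(k_μ, t) = exp(i ⟨Σ_μ (-1)^{b_μ} k_μ, t⟩_-)`.
[cite: FeldmanKnorrerTrubowitz2004Ladders, Definition I.4 (ii) (p.5 L48–64)] -/
theorem prod_legPhase_const (k : Fin 4 → SpT) (t : SpT) :
    ∏ μ : Fin 4, legPhase μ (k μ) t =
      Complex.exp (Complex.I * (mink (∑ μ : Fin 4, ((-1 : ℝ) ^ bExp μ) • k μ) t : ℂ)) := by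
  rw [mink_sum_left, Complex.ofReal_sum, Finset.mul_sum, Complex.exp_sum]
  refine Finset.prod_congr rfl fun μ _ => ?_
  simp only [legPhase, mink_smul_left]
  push_cast
  ring_nf

/-- **On the momentum-conservation surface the full phase is translation invariant**: if
`k₁ - k₂ - k₃ + k₄ = 0` then `∏_μ e_μ(k_μ, x_μ + t) = ∏_μ e_μ(k_μ, x_μ)`.
[cite: FeldmanKnorrerTrubowitz2004Ladders, Definition I.5 (ii) (p.5 L95–108)] -/
theorem prod_legPhase_add_of_surface (k x : Fin 4 → SpT) (t : SpT)
    (hk : k 0 - k 1 - k 2 + k 3 = 0) :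
    ∏ μ : Fin 4, legPhase μ (k μ) (x μ + t) = ∏ μ : Fin 4, legPhase μ (k μ) (x μ) := by
  simp_rw [legPhase_add_right]
  rw [Finset.prod_mul_distrib, prod_legPhase_const, sum_neg_one_pow_bExp_smul, hk, mink_zero_left]
  simp

/-- Continuity of the leg phase in both arguments. [cite: FeldmanKnorrerTrubowitz2004Ladders, Definition I.4 (ii) (p.5 L52–55)] -/
theorem continuous_legPhase (μ : Fin 4) : Continuous fun p : SpT × SpT => legPhase μ p.1 p.2 := by
  unfold legPhase
  exact Complex.continuous_exp.comp
    (continuous_const.mul (Complex.continuous_ofReal.comp continuous_mink))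

/-! ### §1 Inserting one coordinate: a measure-preserving equivalence `X × (κ' → X) ≃ᵐ (κ → X)` -/

/-- Splitting a finite product at a distinguished index `a`, the other indices being enumerated by an
injection `e : κ' → κ` onto `{a}ᶜ` with partial inverse `g`. [cite: FeldmanKnorrerTrubowitz2004Ladders, Definition I.5 (ii) (p.5 L95–108), the pinned position leg] -/
theorem prod_eq_mul_prod_insert {κ κ' : Type*} [Fintype κ] [Fintype κ'] [DecidableEq κ]
    {M : Type*} [CommMonoid M] (a : κ) (e : κ' → κ) (g : κ → κ') (hge : ∀ j, g (e j) = j)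
    (heg : ∀ m, m ≠ a → e (g m) = m) (hea : ∀ j, e j ≠ a) (h : κ → M) :
    ∏ m, h m = h a * ∏ j, h (e j) := by
  rw [← Finset.mul_prod_erase Finset.univ h (Finset.mem_univ a)]
  congr 1
  refine Finset.prod_nbij' g e (fun _ _ => Finset.mem_univ _)
    (fun j _ => Finset.mem_erase.2 ⟨hea j, Finset.mem_univ _⟩) (fun m hm => ?_) (fun j _ => hge j)
    (fun m hm => ?_)
  · exact heg m (Finset.mem_erase.1 hm).1
  · rw [heg m (Finset.mem_erase.1 hm).1]

/-- **Inserting one coordinate.**  For a distinguished index `a : κ` and an enumeration `e : κ' → κ` of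
the other indices (partial inverse `g`), the map `(τ, u) ↦ (m ↦ if m = a then τ else u (g m))` is a
measurable equivalence `X × (κ' → X) ≃ᵐ (κ → X)` preserving the product volumes.  This is how one
position variable is split off a multiple position integral. [cite: FeldmanKnorrerTrubowitz2004Ladders, Definition I.5 (ii) (p.5 L95–108) and Definition I.18 (p.8 L55–93)] -/
theorem exists_measurableEquiv_insert {X : Type*} [MeasureSpace X] [SigmaFinite (volume : Measure X)]
    {κ κ' : Type*} [Fintype κ] [Fintype κ'] [DecidableEq κ] (a : κ) (e : κ' → κ) (g : κ → κ')
    (hge : ∀ j, g (e j) = j) (heg : ∀ m, m ≠ a → e (g m) = m) (hea : ∀ j, e j ≠ a) :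
    ∃ Φ : X × (κ' → X) ≃ᵐ (κ → X), MeasurePreserving Φ volume volume ∧
      (∀ (τ : X) (u : κ' → X), (Φ (τ, u) : κ → X) = fun m => if m = a then τ else u (g m)) ∧
      ∀ x : κ → X, Φ.symm x = (x a, fun j => x (e j)) := by
  let Φ : X × (κ' → X) ≃ᵐ (κ → X) :=
    { toFun := fun z m => if m = a then z.1 else z.2 (g m)
      invFun := fun x => (x a, fun j => x (e j))
      left_inv := by
        rintro ⟨τ, u⟩
        simp only [if_true, Prod.mk.injEq]
        refine ⟨trivial, ?_⟩
        funext j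
        simp [hea j, hge j]
      right_inv := by
        intro x
        funext m
        by_cases hm : m = a
        · subst hm; simp
        · simp [hm, heg m hm]
      measurable_toFun := by
        show Measurable fun z : X × (κ' → X) => fun m => if m = a then z.1 else z.2 (g m)
        refine measurable_pi_lambda _ fun m => ?_
        show Measurable fun z : X × (κ' → X) => if m = a then z.1 else z.2 (g m)
        by_cases hm : m = a
        · have h' : (fun z : X × (κ' → X) => if m = a then z.1 else z.2 (g m)) = fun z => z.1 := by
            funext z; rw [if_pos hm]
          rw [h']; exact measurable_fst
        · have h' : (fun z : X × (κ' → X) => if m = a then z.1 else z.2 (g m)) =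
              fun z => z.2 (g m) := by
            funext z; rw [if_neg hm]
          rw [h']; exact (measurable_pi_apply _).comp measurable_snd
      measurable_invFun := by
        show Measurable fun x : κ → X => (x a, fun j => x (e j))
        exact (measurable_pi_apply a).prodMk
          (measurable_pi_lambda _ fun j => measurable_pi_apply (e j)) }
  have hΦ : ∀ (τ : X) (u : κ' → X), (Φ (τ, u) : κ → X) = fun m => if m = a then τ else u (g m) :=
    fun _ _ => rfl
  refine ⟨Φ, ⟨Φ.measurable, ?_⟩, hΦ, fun _ => rfl⟩
  show Measure.map Φ volume = Measure.pi fun _ => volume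
  refine (Measure.pi_eq fun s hs => ?_).symm
  rw [Measure.map_apply Φ.measurable (MeasurableSet.univ_pi hs)]
  have hpre : (Φ : X × (κ' → X) → (κ → X)) ⁻¹' (Set.pi univ s) =
      s a ×ˢ Set.pi univ (fun j => s (e j)) := by
    ext ⟨τ, u⟩
    simp only [Set.mem_preimage, hΦ, Set.mem_pi, Set.mem_univ, true_implies, Set.mem_prod]
    constructor
    · intro h
      refine ⟨by simpa using h a, fun j => ?_⟩
      have := h (e j)
      rwa [if_neg (hea j), hge j] at this
    · rintro ⟨hτ, hu⟩ m
      by_cases hm : m = a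
      · subst hm; simpa using hτ
      · rw [if_neg hm]
        have := hu (g m)
        rwa [heg m hm] at this
  rw [hpre, Measure.volume_eq_prod, Measure.prod_prod, volume_pi_pi]
  exact (prod_eq_mul_prod_insert a e g hge heg hea (fun m => volume (s m))).symm

/-! ### §2 Invariance of the volumes on `ℝ × ℝ²` and its powers

Type-class inference does not see through `volume` on `SpT = ℝ × (Fin 2 → ℝ)` to the product
instances; we record the Haar property and its consequences as (private) theorems. -/

/-- `volume` on `ℝ × ℝ²` is an additive Haar measure. [folklore] -/
private theorem isAddHaarMeasure_volume_SpT : (volume : Measure SpT).IsAddHaarMeasure := by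
  rw [Measure.volume_eq_prod]; infer_instance

/-- `volume` on `ℝ × ℝ²` is invariant under `x ↦ -x`. [folklore] -/
private theorem isNegInvariant_volume_SpT : (volume : Measure SpT).IsNegInvariant := by
  haveI := isAddHaarMeasure_volume_SpT; infer_instance

/-- `volume` on a finite power of `ℝ × ℝ²` is translation invariant (right). [folklore] -/
private theorem isAddRightInvariant_volume_pi_SpT {κ : Type*} [Fintype κ] :
    (volume : Measure (κ → SpT)).IsAddRightInvariant := by
  haveI := isAddHaarMeasure_volume_SpT
  show (Measure.pi fun _ : κ => (volume : Measure SpT)).IsAddRightInvariant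
  infer_instance

/-! ### §3 The Fubini computation: `χ̂`-convolutions against the phase transform -/

/-- A pure phase `e^{i c r}` has modulus one. [cite: FeldmanKnorrerTrubowitz2004Ladders, Definition I.4 (ii) (p.5 L52–55)] -/
theorem norm_cexp_I_mul_ofReal_mul_ofReal (c r : ℝ) :
    ‖Complex.exp (Complex.I * (c : ℂ) * (r : ℂ))‖ = 1 := by
  rw [Complex.norm_exp]; simp

/-- A pure phase `e^{-i c r}` has modulus one. [cite: FeldmanKnorrerTrubowitz2004Ladders, Definition I.4 (ii) (p.5 L52–55)] -/
theorem norm_cexp_neg_I_mul_ofReal_mul_ofReal (c r : ℝ) :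
    ‖Complex.exp (-(Complex.I * (c : ℂ) * (r : ℂ)))‖ = 1 := by
  rw [Complex.norm_exp]; simp

/-- `χ̂` of a non-integrable `χ` is the junk value `0`: the defining Bochner integral (§I.7) diverges for
every `x`, the phase having modulus one. [cite: FeldmanKnorrerTrubowitz2004Ladders, §I.7 (p.8 L34–38)] -/
theorem chiHat_eq_zero_of_not_integrable (χ : SpT → ℝ)
    (hχ : ¬ Integrable (fun p : SpT => (χ p : ℂ))) (x : SpT) : chiHat χ x = 0 := by
  unfold chiHat
  rw [integral_undef, mul_zero]
  intro hint
  apply hχ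
  have hmeas : AEStronglyMeasurable (fun p : SpT => Complex.exp (Complex.I * (mink p x : ℂ))) volume := by
    refine Continuous.aestronglyMeasurable ?_
    fun_prop
  have h := hint.bdd_mul hmeas (c := 1) (ae_of_all _ fun p => le_of_eq (by
    rw [Complex.norm_exp]; simp))
  refine h.congr (ae_of_all _ fun p => ?_)
  show Complex.exp (Complex.I * (mink p x : ℂ)) * (Complex.exp (-(Complex.I * (mink p x : ℂ))) * (χ p : ℂ)) =
    (χ p : ℂ)
  rw [← mul_assoc, ← Complex.exp_add, add_neg_cancel, Complex.exp_zero, one_mul]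

/-- **The Fubini step of the support argument.**  Let `χ_j ∈ L¹(ℝ × ℝ²)`, signs `σ_j`, and
`G ∈ L¹((κ → ℝ × ℝ²))`.  If the phase transform `Ĝ_σ(q) = ∫ (∏_j e^{iσ_j⟨q_j,u_j⟩_-}) G(u) du`
satisfies `(∏_j χ_j(q_j)) · Ĝ_σ(q) = 0` for every `q`, then the convolution with the `χ̂_j` vanishes
identically: `∫ (∏_j χ̂_j(σ_j(w_j - u_j))) G(u) du = 0` for every `w`.  (Proof: insert the definition of
`χ̂_j` (§I.7), write the product of the `q_j`-integrals as one integral over `q`, swap `∫du ∫dq` — the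
integrand is dominated by `|∏χ_j(q_j)| |G(u)|` — and factor `e^{iσ_j⟨q_j, w_j - u_j⟩}`.)
[cite: FeldmanKnorrerTrubowitz2004Ladders, Lemma II.16, proof (p.13 L48–53), with Definition I.18 (p.8 L55–93) and §I.7 (p.8 L34–38)] -/
theorem integral_prod_chiHat_mul_eq_zero {κ : Type*} [Fintype κ] (χ : κ → SpT → ℝ) (σ : κ → ℝ)
    (G : (κ → SpT) → ℂ) (hG : Integrable G) (hχ : ∀ j, Integrable (fun p : SpT => (χ j p : ℂ)))
    (HC : ∀ q : κ → SpT, (∏ j, (χ j (q j) : ℂ)) *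
        ∫ u : κ → SpT, (∏ j, Complex.exp (Complex.I * (σ j : ℂ) * (mink (q j) (u j) : ℂ))) * G u = 0)
    (w : κ → SpT) :
    ∫ u : κ → SpT, (∏ j, chiHat (χ j) (σ j • (w j - u j))) * G u = 0 := by
  set C : ℂ := (((2 * Real.pi) ^ (3 : ℕ) : ℂ)⁻¹) ^ Fintype.card κ with hC
  have hsplit : ∀ (q u : κ → SpT) (j : κ),
      Complex.exp (-(Complex.I * (mink (q j) (σ j • (w j - u j)) : ℂ))) =
        Complex.exp (-(Complex.I * (σ j : ℂ) * (mink (q j) (w j) : ℂ))) *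
          Complex.exp (Complex.I * (σ j : ℂ) * (mink (q j) (u j) : ℂ)) := by
    intro q u j
    rw [← Complex.exp_add, mink_smul_right, mink_sub_right]
    push_cast
    ring_nf
  -- Step 1: the product of the `χ̂_j` as ONE integral over `q : κ → SpT`
  have hprod : ∀ u : κ → SpT, (∏ j, chiHat (χ j) (σ j • (w j - u j))) =
      C * ∫ q : κ → SpT, ∏ j, (Complex.exp (-(Complex.I * (mink (q j) (σ j • (w j - u j)) : ℂ))) *
        (χ j (q j) : ℂ)) := by
    intro u
    simp only [chiHat]
    rw [Finset.prod_mul_distrib, Finset.prod_const, Finset.card_univ, hC]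
    congr 1
    exact (integral_fintype_prod_eq_prod (𝕜 := ℂ) (μ := fun _ => (volume : Measure SpT))
      (fun j (p : SpT) => Complex.exp (-(Complex.I * (mink p (σ j • (w j - u j)) : ℂ))) *
        (χ j p : ℂ))).symm
  -- Step 2: the integrand on the product space, and its integrability
  set Ψ : (κ → SpT) → (κ → SpT) → ℂ := fun u q =>
    (∏ j, Complex.exp (-(Complex.I * (mink (q j) (σ j • (w j - u j)) : ℂ))) * (χ j (q j) : ℂ)) * G u
    with hΨdef
  have hΨ : ∀ u q, Ψ u q = (∏ j, Complex.exp (-(Complex.I * (σ j : ℂ) * (mink (q j) (w j) : ℂ)))) *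
      (∏ j, Complex.exp (Complex.I * (σ j : ℂ) * (mink (q j) (u j) : ℂ))) *
        ((∏ j, (χ j (q j) : ℂ)) * G u) := by
    intro u q
    simp only [hΨdef, hsplit, Finset.prod_mul_distrib]
    ring
  have hX : Integrable (fun q : κ → SpT => ∏ j, (χ j (q j) : ℂ)) :=
    Integrable.fintype_prod (f := fun j (p : SpT) => (χ j p : ℂ)) (μ := fun _ => volume) hχ
  have hint : Integrable (Function.uncurry Ψ) ((volume : Measure (κ → SpT)).prod volume) := by
    have h1 : Integrable (fun z : (κ → SpT) × (κ → SpT) => G z.1 * ∏ j, (χ j (z.2 j) : ℂ))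
        ((volume : Measure (κ → SpT)).prod volume) := hG.mul_prod hX
    have hmeas : AEStronglyMeasurable (fun z : (κ → SpT) × (κ → SpT) =>
        (∏ j, Complex.exp (-(Complex.I * (σ j : ℂ) * (mink (z.2 j) (w j) : ℂ)))) *
          ∏ j, Complex.exp (Complex.I * (σ j : ℂ) * (mink (z.2 j) (z.1 j) : ℂ)))
        ((volume : Measure (κ → SpT)).prod volume) := by
      refine Continuous.aestronglyMeasurable ?_
      refine Continuous.mul (continuous_finsetProd _ fun j _ => ?_)
        (continuous_finsetProd _ fun j _ => ?_) <;> fun_prop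
    have h2 := h1.bdd_mul hmeas (c := 1) (ae_of_all _ fun z => by
      rw [norm_mul, norm_prod, norm_prod]
      simp [norm_cexp_I_mul_ofReal_mul_ofReal, norm_cexp_neg_I_mul_ofReal_mul_ofReal])
    refine h2.congr (ae_of_all _ fun z => ?_)
    show _ = Ψ z.1 z.2
    rw [hΨ]; ring
  -- Step 3: swap and factor
  calc ∫ u : κ → SpT, (∏ j, chiHat (χ j) (σ j • (w j - u j))) * G u
      = ∫ u : κ → SpT, C * ∫ q : κ → SpT, Ψ u q := by
        refine integral_congr_ae (ae_of_all _ fun u => ?_)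
        show (∏ j, chiHat (χ j) (σ j • (w j - u j))) * G u = C * ∫ q : κ → SpT, Ψ u q
        rw [hprod, mul_assoc, ← integral_mul_const]
    _ = C * ∫ u : κ → SpT, ∫ q : κ → SpT, Ψ u q := integral_const_mul C _
    _ = C * ∫ q : κ → SpT, ∫ u : κ → SpT, Ψ u q := by rw [integral_integral_swap hint]
    _ = C * ∫ q : κ → SpT, (∏ j, Complex.exp (-(Complex.I * (σ j : ℂ) * (mink (q j) (w j) : ℂ)))) *
          ((∏ j, (χ j (q j) : ℂ)) *
            ∫ u : κ → SpT,
              (∏ j, Complex.exp (Complex.I * (σ j : ℂ) * (mink (q j) (u j) : ℂ))) * G u) := by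
        congr 1
        refine integral_congr_ae (ae_of_all _ fun q => ?_)
        show ∫ u : κ → SpT, Ψ u q = _
        dsimp only
        rw [← integral_const_mul, ← integral_const_mul]
        refine integral_congr_ae (ae_of_all _ fun u => ?_)
        show Ψ u q = _
        dsimp only
        rw [hΨ]; ring
    _ = 0 := by simp [HC]

/-! ### §4 The pinned Fourier transform and re-pinning

The tree's `totalFT i g k` (Definition I.5 (ii)) integrates the position legs other than the pinned
leg `μ₀ := h.choose` against the leg phases, the pinned leg sitting at the origin; the vector fed to
`g` is `fun μ => if h' : i μ = 1 ∧ μ ≠ μ₀ then x ⟨μ, h'⟩ else if μ = μ₀ then 0 else k μ` (for the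
all-position component the last branch is never taken).  We call this shape "pinned at `μ₀`" and
prove that on the conservation surface the pinned transform of a translation-invariant function does
not depend on the pinned leg. -/

/-- The tree's total Fourier transform, unfolded at a proof `h` of "there is a position leg": it is the
transform pinned at `h.choose`. [cite: FeldmanKnorrerTrubowitz2004Ladders, Definition I.5 (ii) (p.5 L95–108)] -/
theorem totalFT_eq_of_exists {i : LegKind} (h : ∃ μ, i μ = 1) (g : (Fin 4 → SpT) → ℂ)
    (k : Fin 4 → SpT) :
    totalFT i g k = ∫ x : {μ : Fin 4 // i μ = 1 ∧ μ ≠ h.choose} → SpT,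
      (∏ μ : {μ : Fin 4 // i μ = 1 ∧ μ ≠ h.choose}, legPhase μ.1 (k μ.1) (x μ)) *
        g (fun μ => if h' : i μ = 1 ∧ μ ≠ h.choose then x ⟨μ, h'⟩
          else if μ = h.choose then 0 else k μ) := by
  unfold totalFT
  rw [dif_pos h]

/-- For the all-position component the "momentum" branch of the pinned vector is never taken, so the
pinned vector does not depend on the momenta `k` it nominally reads.
[cite: FeldmanKnorrerTrubowitz2004Ladders, Definition I.5 (ii) (p.5 L95–108)] -/
theorem legFill_congr {i : LegKind} (hi : ∀ μ, i μ = 1) (π : Fin 4) (c : SpT) (k k' : Fin 4 → SpT)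
    (u : {μ : Fin 4 // i μ = 1 ∧ μ ≠ π} → SpT) :
    (fun μ : Fin 4 => if h' : i μ = 1 ∧ μ ≠ π then u ⟨μ, h'⟩ else if μ = π then c else k μ) =
      fun μ => if h' : i μ = 1 ∧ μ ≠ π then u ⟨μ, h'⟩ else if μ = π then c else k' μ := by
  funext μ
  by_cases h' : i μ = 1 ∧ μ ≠ π
  · rw [dif_pos h', dif_pos h']
  · have hμ : μ = π := by
      by_contra hne
      exact h' ⟨hi μ, hne⟩
    rw [dif_neg h', dif_neg h', if_pos hμ, if_pos hμ]

/-- The pinned vector at the pinned leg. [cite: FeldmanKnorrerTrubowitz2004Ladders, Definition I.5 (ii) (p.5 L95–108)] -/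
theorem legFill_apply_self {i : LegKind} (π : Fin 4) (c : SpT) (k : Fin 4 → SpT)
    (u : {μ : Fin 4 // i μ = 1 ∧ μ ≠ π} → SpT) :
    (if h' : i π = 1 ∧ π ≠ π then u ⟨π, h'⟩ else if π = π then c else k π) = c := by
  simp

/-- The pinned vector off the pinned leg. [cite: FeldmanKnorrerTrubowitz2004Ladders, Definition I.5 (ii) (p.5 L95–108)] -/
theorem legFill_apply_of_ne {i : LegKind} (hi : ∀ μ, i μ = 1) (π : Fin 4) (c : SpT)
    (k : Fin 4 → SpT) (u : {μ : Fin 4 // i μ = 1 ∧ μ ≠ π} → SpT) {μ : Fin 4} (hμ : μ ≠ π) :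
    (if h' : i μ = 1 ∧ μ ≠ π then u ⟨μ, h'⟩ else if μ = π then c else k μ) = u ⟨μ, hi μ, hμ⟩ := by
  rw [dif_pos (show i μ = 1 ∧ μ ≠ π from ⟨hi μ, hμ⟩)]

/-- The phase product over the position legs other than the pinned one equals the FULL phase product
of the pinned vector (the pinned leg sits at the origin and contributes `1`).
[cite: FeldmanKnorrerTrubowitz2004Ladders, Definition I.5 (ii) (p.5 L95–108)] -/
theorem prod_legPhase_legFill {i : LegKind} (hi : ∀ μ, i μ = 1) (π : Fin 4) (k k' : Fin 4 → SpT)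
    (u : {μ : Fin 4 // i μ = 1 ∧ μ ≠ π} → SpT) :
    ∏ μ : Fin 4, legPhase μ (k μ)
        ((fun ν : Fin 4 => if h' : i ν = 1 ∧ ν ≠ π then u ⟨ν, h'⟩ else if ν = π then (0 : SpT)
          else k' ν) μ) =
      ∏ μ : {μ : Fin 4 // i μ = 1 ∧ μ ≠ π}, legPhase μ.1 (k μ.1) (u μ) := by
  classical
  beta_reduce
  rw [← Finset.mul_prod_erase Finset.univ _ (Finset.mem_univ π),
    Finset.prod_subtype (F := inferInstance) (Finset.univ.erase π) (p := fun μ => i μ = 1 ∧ μ ≠ π)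
      (fun μ => by simp [hi μ])]
  rw [legFill_apply_self, legPhase_zero_right, one_mul]
  refine Finset.prod_congr rfl fun j _ => ?_
  rw [legFill_apply_of_ne hi π 0 k' u j.2.2]

/-- **Re-pinning.**  For a translation-invariant function of four positions whose pinned sections are
integrable, the Fourier transform pinned at leg `π` and the one pinned at leg `π'` agree at every
momentum configuration on the conservation surface `k₁ - k₂ - k₃ + k₄ = 0` (print: `f̌` "is defined only
where `k₁ - k₂ = k₃ - k₄`" — the delta function realised by pinning any one leg).  Proof: split off
the position of leg `π'` resp. `π` (§1), translate the remaining positions (Haar invariance), reflect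
the split variable, and use Fubini twice. [cite: FeldmanKnorrerTrubowitz2004Ladders, Definition I.5 (ii) (p.5 L95–108)] -/
theorem pinFT_eq_pinFT {i : LegKind} (hi : ∀ μ, i μ = 1) (F : (Fin 4 → SpT) → ℂ)
    (hT : ∀ (x : Fin 4 → SpT) (t : SpT), F (fun μ => x μ + t) = F x) (k : Fin 4 → SpT)
    (hk : k 0 - k 1 - k 2 + k 3 = 0) (π π' : Fin 4)
    (hπ : Integrable fun u : {μ : Fin 4 // i μ = 1 ∧ μ ≠ π} → SpT =>
      F (fun μ => if h' : i μ = 1 ∧ μ ≠ π then u ⟨μ, h'⟩ else if μ = π then 0 else k μ))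
    (hπ' : Integrable fun u : {μ : Fin 4 // i μ = 1 ∧ μ ≠ π'} → SpT =>
      F (fun μ => if h' : i μ = 1 ∧ μ ≠ π' then u ⟨μ, h'⟩ else if μ = π' then 0 else k μ)) :
    ∫ u : {μ : Fin 4 // i μ = 1 ∧ μ ≠ π} → SpT,
        (∏ μ : {μ : Fin 4 // i μ = 1 ∧ μ ≠ π}, legPhase μ.1 (k μ.1) (u μ)) *
          F (fun μ => if h' : i μ = 1 ∧ μ ≠ π then u ⟨μ, h'⟩ else if μ = π then 0 else k μ) =
      ∫ u : {μ : Fin 4 // i μ = 1 ∧ μ ≠ π'} → SpT,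
        (∏ μ : {μ : Fin 4 // i μ = 1 ∧ μ ≠ π'}, legPhase μ.1 (k μ.1) (u μ)) *
          F (fun μ => if h' : i μ = 1 ∧ μ ≠ π' then u ⟨μ, h'⟩ else if μ = π' then 0 else k μ) := by
  classical
  rcases eq_or_ne π π' with rfl | hne
  · rfl
  have h3 : ∀ a b : Fin 4, ∃ c : Fin 4, c ≠ a ∧ c ≠ b := by decide
  obtain ⟨ρ, hρπ, hρπ'⟩ := h3 π π'
  -- the two insertion equivalences over the legs `∉ {π, π'}`
  obtain ⟨J, hJmp, hJ, -⟩ := exists_measurableEquiv_insert (X := SpT)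
    (κ := {μ : Fin 4 // i μ = 1 ∧ μ ≠ π}) (κ' := {μ : Fin 4 // i μ = 1 ∧ μ ≠ π ∧ μ ≠ π'})
    ⟨π', hi π', hne.symm⟩ (fun j => ⟨j.1, j.2.1, j.2.2.1⟩)
    (fun m => if h : m.1 ≠ π' then ⟨m.1, m.2.1, m.2.2, h⟩ else ⟨ρ, hi ρ, hρπ, hρπ'⟩)
    (fun j => by simp [j.2.2.2]) (fun m hm => by
      have hm' : m.1 ≠ π' := fun h => hm (Subtype.ext h)
      simp [hm'])
    (fun j h => j.2.2.2 (congrArg Subtype.val h))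
  obtain ⟨J', hJ'mp, hJ', -⟩ := exists_measurableEquiv_insert (X := SpT)
    (κ := {μ : Fin 4 // i μ = 1 ∧ μ ≠ π'}) (κ' := {μ : Fin 4 // i μ = 1 ∧ μ ≠ π ∧ μ ≠ π'})
    ⟨π, hi π, hne⟩ (fun j => ⟨j.1, j.2.1, j.2.2.2⟩)
    (fun m => if h : m.1 ≠ π then ⟨m.1, m.2.1, h, m.2.2⟩ else ⟨ρ, hi ρ, hρπ, hρπ'⟩)
    (fun j => by simp [j.2.2.1]) (fun m hm => by
      have hm' : m.1 ≠ π := fun h => hm (Subtype.ext h)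
      simp [hm'])
    (fun j h => j.2.2.1 (congrArg Subtype.val h))
  -- the two integrands
  set Λ : ({μ : Fin 4 // i μ = 1 ∧ μ ≠ π} → SpT) → ℂ := fun u =>
    (∏ μ : {μ : Fin 4 // i μ = 1 ∧ μ ≠ π}, legPhase μ.1 (k μ.1) (u μ)) *
      F (fun μ => if h' : i μ = 1 ∧ μ ≠ π then u ⟨μ, h'⟩ else if μ = π then 0 else k μ) with hΛ
  set Λ' : ({μ : Fin 4 // i μ = 1 ∧ μ ≠ π'} → SpT) → ℂ := fun u =>
    (∏ μ : {μ : Fin 4 // i μ = 1 ∧ μ ≠ π'}, legPhase μ.1 (k μ.1) (u μ)) *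
      F (fun μ => if h' : i μ = 1 ∧ μ ≠ π' then u ⟨μ, h'⟩ else if μ = π' then 0 else k μ) with hΛ'
  -- integrability of the integrands (phases have modulus one)
  have hΛi : Integrable Λ := by
    refine hπ.bdd_mul (c := 1) (Continuous.aestronglyMeasurable ?_) (ae_of_all _ fun u => ?_)
    · exact continuous_finsetProd _ fun μ _ => (continuous_legPhase μ.1).comp
        (continuous_const.prodMk (continuous_apply μ))
    · rw [norm_prod]; simp [norm_legPhase]
  have hΛ'i : Integrable Λ' := by
    refine hπ'.bdd_mul (c := 1) (Continuous.aestronglyMeasurable ?_) (ae_of_all _ fun u => ?_)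
    · exact continuous_finsetProd _ fun μ _ => (continuous_legPhase μ.1).comp
        (continuous_const.prodMk (continuous_apply μ))
    · rw [norm_prod]; simp [norm_legPhase]
  -- the pointwise identity between the two split integrands
  have hkey : ∀ (τ : SpT) (w : {μ : Fin 4 // i μ = 1 ∧ μ ≠ π ∧ μ ≠ π'} → SpT),
      Λ (J (τ, w)) = Λ' (J' (-τ, fun j => w j - τ)) := by
    intro τ w
    have hXX' : (fun μ : Fin 4 => if h' : i μ = 1 ∧ μ ≠ π' then (J' (-τ, fun j => w j - τ)) ⟨μ, h'⟩
        else if μ = π' then (0 : SpT) else k μ) =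
        fun μ => (fun ν : Fin 4 => if h' : i ν = 1 ∧ ν ≠ π then (J (τ, w)) ⟨ν, h'⟩
          else if ν = π then (0 : SpT) else k ν) μ + -τ := by
      funext μ
      beta_reduce
      by_cases hμπ : μ = π
      · subst hμπ
        rw [legFill_apply_self, legFill_apply_of_ne hi π' 0 k _ hne, hJ']
        simp
      · rw [legFill_apply_of_ne hi π 0 k _ hμπ, hJ]
        by_cases hμπ' : μ = π'
        · subst hμπ'
          rw [legFill_apply_self]
          simp
        · rw [legFill_apply_of_ne hi π' 0 k _ hμπ', hJ']
          simp [hμπ, hμπ', sub_eq_add_neg]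
    calc Λ (J (τ, w))
        = (∏ μ : Fin 4, legPhase μ (k μ) ((fun ν : Fin 4 => if h' : i ν = 1 ∧ ν ≠ π then
              (J (τ, w)) ⟨ν, h'⟩ else if ν = π then (0 : SpT) else k ν) μ)) *
            F (fun ν : Fin 4 => if h' : i ν = 1 ∧ ν ≠ π then (J (τ, w)) ⟨ν, h'⟩
              else if ν = π then (0 : SpT) else k ν) := by
          rw [hΛ, prod_legPhase_legFill hi π k k]
      _ = (∏ μ : Fin 4, legPhase μ (k μ) ((fun ν : Fin 4 => if h' : i ν = 1 ∧ ν ≠ π' then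
              (J' (-τ, fun j => w j - τ)) ⟨ν, h'⟩ else if ν = π' then (0 : SpT) else k ν) μ)) *
            F (fun ν : Fin 4 => if h' : i ν = 1 ∧ ν ≠ π' then (J' (-τ, fun j => w j - τ)) ⟨ν, h'⟩
              else if ν = π' then (0 : SpT) else k ν) := by
          rw [hXX', prod_legPhase_add_of_surface k _ (-τ) hk, hT]
      _ = Λ' (J' (-τ, fun j => w j - τ)) := by
          rw [hΛ', prod_legPhase_legFill hi π' k k]
  -- transport both sides to `SpT × (legs ∉ {π, π'} → SpT)` and compare the iterated integrals
  have hΛJ : Integrable (fun z => Λ (J z)) ((volume : Measure SpT).prod volume) := by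
    have := (hJmp.integrable_comp_emb J.measurableEmbedding).2 hΛi
    rwa [Measure.volume_eq_prod] at this
  have hΛ'J' : Integrable (fun z => Λ' (J' z)) ((volume : Measure SpT).prod volume) := by
    have := (hJ'mp.integrable_comp_emb J'.measurableEmbedding).2 hΛ'i
    rwa [Measure.volume_eq_prod] at this
  haveI := isNegInvariant_volume_SpT
  haveI := isAddRightInvariant_volume_pi_SpT (κ := {μ : Fin 4 // i μ = 1 ∧ μ ≠ π ∧ μ ≠ π'})
  calc ∫ u, Λ u = ∫ z, Λ (J z) := (hJmp.integral_comp' Λ).symm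
    _ = ∫ z, Λ (J z) ∂((volume : Measure SpT).prod volume) := rfl
    _ = ∫ τ : SpT, ∫ w : {μ : Fin 4 // i μ = 1 ∧ μ ≠ π ∧ μ ≠ π'} → SpT, Λ (J (τ, w)) :=
        integral_prod _ hΛJ
    _ = ∫ τ : SpT, ∫ w : {μ : Fin 4 // i μ = 1 ∧ μ ≠ π ∧ μ ≠ π'} → SpT, Λ' (J' (-τ, w)) := by
        refine integral_congr_ae (ae_of_all _ fun τ => ?_)
        show ∫ w, Λ (J (τ, w)) = ∫ w, Λ' (J' (-τ, w))
        simp_rw [hkey τ]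
        exact integral_sub_right_eq_self (μ := volume)
          (fun v : {μ : Fin 4 // i μ = 1 ∧ μ ≠ π ∧ μ ≠ π'} → SpT => Λ' (J' (-τ, v))) (fun _ => τ)
    _ = ∫ τ : SpT, ∫ w : {μ : Fin 4 // i μ = 1 ∧ μ ≠ π ∧ μ ≠ π'} → SpT, Λ' (J' (τ, w)) :=
        integral_neg_eq_self (fun τ => ∫ w, Λ' (J' (τ, w))) volume
    _ = ∫ z, Λ' (J' z) ∂((volume : Measure SpT).prod volume) := (integral_prod _ hΛ'J').symm
    _ = ∫ z, Λ' (J' z) := rfl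
    _ = ∫ u, Λ' u := hJ'mp.integral_comp' Λ'

/-! ### §5 Assembly: the off-diagonal terms of a resectorisation vanish -/

/-- The all-position component of a translation-invariant function is invariant under a common
translation of the four positions (Definition I.4 (ii) with no momentum leg: the phase factor is an
empty product). [cite: FeldmanKnorrerTrubowitz2004Ladders, Definition I.4 (ii) (p.5 L48–64)] -/
theorem apply_add_const_of_isTranslationInvariant {i : LegKind} (hi : ∀ μ, i μ = 1)
    {f : FourLegFn} (htr : IsTranslationInvariant f) (x : Fin 4 → SpT) (t : SpT)
    (s : Fin 4 → Arc) : f i (fun μ => x μ + t) s = f i x s := by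
  have h := htr.1 i t x s
  have htr' : translate i t x = fun μ => x μ + t := by
    funext μ; simp [translate, hi μ]
  have hone : (∏ μ : Fin 4, if i μ = 0 then legPhase μ (x μ) t else 1) = 1 :=
    Finset.prod_eq_one fun μ _ => by simp [hi μ]
  rw [htr', hone, one_mul] at h
  exact h

/-- **The pinned transform of a sectorized function vanishes off the old sectors — for ANY pinned
leg.**  If `f` is sectorized (Definition I.6, rev. 3: on the conservation surface) and translation
invariant, its all-position component has integrable pinned sections, and `k` is a momentum
configuration on the surface `k₁ - k₂ - k₃ + k₄ = 0` with `k_ν ∉ s̃'_ν` for some leg `ν`, then the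
Fourier transform pinned at an arbitrary leg `π` vanishes at `k` (the tree's `totalFT` is the case
`π = Classical.choose _`; the general case follows by re-pinning, `pinFT_eq_pinFT`).
[cite: FeldmanKnorrerTrubowitz2004Ladders, Definition I.6 (p.5 L110–128) with Definition I.5 (ii) (p.5 L95–108)] -/
theorem pinFT_eq_zero_of_not_mem_extSector (S : ScaleData) (e : (Fin 2 → ℝ) → ℝ) (fr : FermiFrame)
    {jl jr : ℕ} {i : LegKind} (hi : ∀ μ, i μ = 1) {f : FourLegFn}
    (hsec : IsSectorized S e fr jl jr f) (htr : IsTranslationInvariant f) (s' : Fin 4 → Arc)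
    (k : Fin 4 → SpT) (hk : k 0 - k 1 - k 2 + k 3 = 0) (π : Fin 4)
    (hint : ∀ π₀ : Fin 4, Integrable fun u : {μ : Fin 4 // i μ = 1 ∧ μ ≠ π₀} → SpT =>
      f i (fun μ => if h' : i μ = 1 ∧ μ ≠ π₀ then u ⟨μ, h'⟩ else if μ = π₀ then 0 else k μ) s')
    {ν : Fin 4} (hν : k ν ∉ extSector S e fr (if ν.val < 2 then jl else jr) (s' ν)) :
    ∫ u : {μ : Fin 4 // i μ = 1 ∧ μ ≠ π} → SpT,
        (∏ μ : {μ : Fin 4 // i μ = 1 ∧ μ ≠ π}, legPhase μ.1 (k μ.1) (u μ)) *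
          f i (fun μ => if h' : i μ = 1 ∧ μ ≠ π then u ⟨μ, h'⟩ else if μ = π then 0 else k μ) s' =
      0 := by
  have h : ∃ μ, i μ = 1 := ⟨0, hi 0⟩
  rw [pinFT_eq_pinFT hi (fun x => f i x s') (fun x t => apply_add_const_of_isTranslationInvariant
      hi htr x t s') k hk π h.choose (hint π) (hint h.choose), ← totalFT_eq_of_exists h (fun y => f i y s') k]
  exact hsec i k s' ν (hi ν) hk hν

/-- The momentum of the pinned leg is determined by conservation: completing the momenta `q` of the
other legs by `k_π := -(-1)^{b_π} Σ_{μ ≠ π} (-1)^{b_μ} q_μ` lands on the surface `k₁ - k₂ - k₃ + k₄ = 0`.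
[cite: FeldmanKnorrerTrubowitz2004Ladders, Definition I.5 (ii) (p.5 L95–108)] -/
theorem surface_of_legFill {i : LegKind} (hi : ∀ μ, i μ = 1) (π : Fin 4)
    (q : {μ : Fin 4 // i μ = 1 ∧ μ ≠ π} → SpT) :
    let k : Fin 4 → SpT := fun μ => if h' : i μ = 1 ∧ μ ≠ π then q ⟨μ, h'⟩ else
      -(((-1 : ℝ) ^ bExp π) • ∑ j : {μ : Fin 4 // i μ = 1 ∧ μ ≠ π}, ((-1 : ℝ) ^ bExp j.1) • q j)
    k 0 - k 1 - k 2 + k 3 = 0 := by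
  classical
  intro k
  rw [← sum_neg_one_pow_bExp_smul, ← Finset.add_sum_erase Finset.univ _ (Finset.mem_univ π),
    Finset.sum_subtype (F := inferInstance) (Finset.univ.erase π) (p := fun μ => i μ = 1 ∧ μ ≠ π)
      (fun μ => by simp [hi μ])]
  have hπ : k π = -(((-1 : ℝ) ^ bExp π) •
      ∑ j : {μ : Fin 4 // i μ = 1 ∧ μ ≠ π}, ((-1 : ℝ) ^ bExp j.1) • q j) := by
    show (if h' : i π = 1 ∧ π ≠ π then q ⟨π, h'⟩ else _) = _
    rw [dif_neg (by simp)]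
  have hj : ∀ j : {μ : Fin 4 // i μ = 1 ∧ μ ≠ π}, k j.1 = q j := by
    intro j
    show (if h' : i j.1 = 1 ∧ j.1 ≠ π then q ⟨j.1, h'⟩ else _) = _
    rw [dif_pos j.2]
  simp_rw [hj, hπ, smul_neg, smul_smul, neg_one_pow_bExp_mul_self, one_smul, neg_add_cancel]

/-- **The off-diagonal terms of a resectorisation vanish (Lemma II.16, support step).**  For
admissible ladder data, the all-position component (`∀ μ, i μ = 1`) of a function `f` sectorized at
the scales `(jl, jr)` (Definition I.6) and translation invariant (Definition I.4), new labels `s` with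
`s μ ∈ Σ_{new scale of μ}` (new scales `jl', jr' ≥ 1`), old labels `s'`, and a leg `ν` whose new and
old extended sectors are disjoint, the `s'`-summand of the resectorisation
`resectFour D jl jr jl' jr' f i y s` (Definition I.18) vanishes for every `y`:
`∫ x', (∏_μ χ̂_{s_μ}((-1)^{b_μ}(y_μ - x'_μ))) f((x'₁,s'₁),…,(x'₄,s'₄)) = 0` — "the integral fails to
vanish identically [only if `s̃_μ ∩ s̃'_μ ≠ ∅` for all `μ`], because `f` is sectorized".  The product
runs over the subtype of any decidable `chg` with `∀ μ, chg μ`, exactly as in `resectFour`.  Beyond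
print we assume the pinned sections of `f i · s'` integrable (the finiteness of the `L¹–L^∞` norm of
Definition I.10; see the module doc-string for why the statement is false without it); `k₀` is the
(unread) momentum junk of the pinned vector. [cite: FeldmanKnorrerTrubowitz2004Ladders, Lemma II.16, proof (p.13 L48–53), with Definitions I.6 (p.5 L110–128) and I.18 (p.8 L55–93)] -/
theorem integral_resect_eq_zero_of_extSector_disjoint (D : LadderData) (hD : D.Admissible)
    {jl jr jl' jr' : ℕ} (h1l : 1 ≤ jl') (h1r : 1 ≤ jr') {i : LegKind} (hi : ∀ μ, i μ = 1)
    {f : FourLegFn} (hsec : IsSectorized D.S D.e D.fr jl jr f) (htr : IsTranslationInvariant f)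
    (s s' : Fin 4 → Arc) (hs : ∀ μ : Fin 4, s μ ∈ (if μ.val < 2 then D.Sig jl' else D.Sig jr'))
    (k₀ : Fin 4 → SpT)
    (hint : ∀ π : Fin 4, Integrable fun u : {μ : Fin 4 // i μ = 1 ∧ μ ≠ π} → SpT =>
      f i (fun μ => if h' : i μ = 1 ∧ μ ≠ π then u ⟨μ, h'⟩ else if μ = π then 0 else k₀ μ) s')
    {ν : Fin 4} (hν : extSector D.S D.e D.fr (if ν.val < 2 then jl' else jr') (s ν) ∩
        extSector D.S D.e D.fr (if ν.val < 2 then jl else jr) (s' ν) = ∅)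
    (chg : Fin 4 → Prop) [DecidablePred chg] (hchg : ∀ μ, chg μ) (y : Fin 4 → SpT) :
    ∫ x' : {μ : Fin 4 // chg μ} → SpT,
        (∏ μ : {μ : Fin 4 // chg μ},
            chiHat (D.χ (if μ.1.val < 2 then jl' else jr') (s μ.1))
              (((-1 : ℝ) ^ bExp μ.1) • (y μ.1 - x' μ))) *
          f i (fun μ => if h : chg μ then x' ⟨μ, h⟩ else y μ) s' = 0 := by
  classical
  -- Step 0: if some cut-off function is not integrable, its `χ̂` is the junk value `0`
  by_cases hχ : ∀ μ : Fin 4, Integrable fun p : SpT =>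
      ((D.χ (if μ.val < 2 then jl' else jr') (s μ) p : ℝ) : ℂ)
  swap
  · obtain ⟨μ, hμ⟩ := not_forall.1 hχ
    have h0 : ∀ x, chiHat (D.χ (if μ.val < 2 then jl' else jr') (s μ)) x = 0 :=
      chiHat_eq_zero_of_not_integrable _ hμ
    refine integral_eq_zero_of_ae (ae_of_all _ fun x' => ?_)
    show _ = (0 : ℂ)
    beta_reduce
    have hprod : (∏ μ' : {μ : Fin 4 // chg μ},
        chiHat (D.χ (if μ'.1.val < 2 then jl' else jr') (s μ'.1))
          (((-1 : ℝ) ^ bExp μ'.1) • (y μ'.1 - x' μ'))) = 0 :=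
      Finset.prod_eq_zero (Finset.mem_univ (⟨μ, hchg μ⟩ : {μ : Fin 4 // chg μ})) (h0 _)
    rw [hprod, zero_mul]
  -- Step 1: the pinned leg `π ≠ ν`, the insertion equivalence at `π`
  obtain ⟨π, hνπ⟩ : ∃ π : Fin 4, ν ≠ π := ⟨if ν = 0 then 1 else 0, by
    by_cases h : ν = 0
    · rw [if_pos h, h]; decide
    · rw [if_neg h]; exact h⟩
  set a : {μ : Fin 4 // chg μ} := ⟨π, hchg π⟩ with ha
  set e : {μ : Fin 4 // i μ = 1 ∧ μ ≠ π} → {μ : Fin 4 // chg μ} := fun j => ⟨j.1, hchg j.1⟩ with he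
  set g : {μ : Fin 4 // chg μ} → {μ : Fin 4 // i μ = 1 ∧ μ ≠ π} := fun m =>
    if h : m.1 ≠ π then ⟨m.1, hi m.1, h⟩ else ⟨ν, hi ν, hνπ⟩ with hg
  have hge : ∀ j, g (e j) = j := fun j => by simp [hg, he, j.2.2]
  have heg : ∀ m, m ≠ a → e (g m) = m := fun m hm => by
    have hm' : m.1 ≠ π := fun h => hm (Subtype.ext h)
    simp [hg, he, hm']
  have hea : ∀ j, e j ≠ a := fun j h => j.2.2 (congrArg Subtype.val h)
  obtain ⟨Φ, hΦmp, hΦ, -⟩ := exists_measurableEquiv_insert (X := SpT) a e g hge heg hea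
  -- abbreviations
  set χ : Fin 4 → SpT → ℝ := fun μ => D.χ (if μ.val < 2 then jl' else jr') (s μ) with hχdef
  set σ : Fin 4 → ℝ := fun μ => (-1 : ℝ) ^ bExp μ with hσdef
  set F : (Fin 4 → SpT) → ℂ := fun x => f i x s' with hFdef
  have hT : ∀ (x : Fin 4 → SpT) (t : SpT), F (fun μ => x μ + t) = F x := fun x t =>
    apply_add_const_of_isTranslationInvariant hi htr x t s'
  set Θ : ({μ : Fin 4 // chg μ} → SpT) → ℂ := fun x' =>
    (∏ μ : {μ : Fin 4 // chg μ}, chiHat (χ μ.1) ((σ μ.1) • (y μ.1 - x' μ))) *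
      F (fun μ => if h : chg μ then x' ⟨μ, h⟩ else y μ) with hΘdef
  -- the pinned section at `π` and the shifted convolution kernel
  set G : ({μ : Fin 4 // i μ = 1 ∧ μ ≠ π} → SpT) → ℂ := fun v =>
    F (fun μ => if h' : i μ = 1 ∧ μ ≠ π then v ⟨μ, h'⟩ else if μ = π then 0 else k₀ μ) with hGdef
  have hG : Integrable G := hint π
  -- Step 2: the integrand along the insertion equivalence
  have hΘΦ : ∀ (τ : SpT) (u : {μ : Fin 4 // i μ = 1 ∧ μ ≠ π} → SpT),
      Θ (Φ (τ, u)) = chiHat (χ π) (σ π • (y π - τ)) *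
        ((fun v : {μ : Fin 4 // i μ = 1 ∧ μ ≠ π} → SpT =>
          (∏ j : {μ : Fin 4 // i μ = 1 ∧ μ ≠ π}, chiHat (χ j.1) (σ j.1 • ((y j.1 - τ) - v j))) * G v)
          (u - fun _ : {μ : Fin 4 // i μ = 1 ∧ μ ≠ π} => τ)) := by
    intro τ u
    have hΦa : (Φ (τ, u)) a = τ := by
      rw [hΦ]; exact if_pos rfl
    have hΦe : ∀ j : {μ : Fin 4 // i μ = 1 ∧ μ ≠ π}, (Φ (τ, u)) (e j) = u j := by
      intro j
      rw [hΦ]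
      exact (if_neg (hea j)).trans (by rw [hge])
    have hX : (fun μ : Fin 4 => if h : chg μ then (Φ (τ, u)) ⟨μ, h⟩ else y μ) =
        fun μ => (fun μ' : Fin 4 => if h' : i μ' = 1 ∧ μ' ≠ π then
          (u - fun _ : {μ : Fin 4 // i μ = 1 ∧ μ ≠ π} => τ) ⟨μ', h'⟩
          else if μ' = π then (0 : SpT) else k₀ μ') μ + τ := by
      funext μ
      beta_reduce
      rw [dif_pos (hchg μ)]
      by_cases hμ : μ = π
      · subst hμ
        rw [legFill_apply_self, zero_add]
        exact hΦa
      · rw [legFill_apply_of_ne hi π 0 k₀ _ hμ]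
        have heμ : (⟨μ, hchg μ⟩ : {μ : Fin 4 // chg μ}) = e ⟨μ, hi μ, hμ⟩ := rfl
        rw [heμ, hΦe]
        simp
    rw [hΘdef]
    beta_reduce
    rw [hX, hT, prod_eq_mul_prod_insert (M := ℂ) a e g hge heg hea, mul_assoc]
    congr 1
    · rw [hΦa]
    · congr 1
      refine Finset.prod_congr rfl fun j _ => ?_
      rw [hΦe j]
      show chiHat (χ j.1) (σ j.1 • (y j.1 - u j)) =
        chiHat (χ j.1) (σ j.1 • (y j.1 - τ - (u - fun _ : {μ : Fin 4 // i μ = 1 ∧ μ ≠ π} => τ) j))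
      congr 2
      simp only [Pi.sub_apply]
      abel
  -- Step 3: the hypothesis of the Fubini lemma — the transform pinned at `π` vanishes where needed
  have HC : ∀ q : {μ : Fin 4 // i μ = 1 ∧ μ ≠ π} → SpT,
      (∏ j : {μ : Fin 4 // i μ = 1 ∧ μ ≠ π}, ((χ j.1) (q j) : ℂ)) *
        ∫ u : {μ : Fin 4 // i μ = 1 ∧ μ ≠ π} → SpT,
          (∏ j : {μ : Fin 4 // i μ = 1 ∧ μ ≠ π},
            Complex.exp (Complex.I * ((σ j.1 : ℝ) : ℂ) * (mink (q j) (u j) : ℂ))) * G u = 0 := by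
    intro q
    by_cases hq : ∃ j : {μ : Fin 4 // i μ = 1 ∧ μ ≠ π}, χ j.1 (q j) = 0
    · obtain ⟨j, hj⟩ := hq
      rw [Finset.prod_eq_zero (Finset.mem_univ j) (by rw [hj]; simp), zero_mul]
    have hq' : ∀ j : {μ : Fin 4 // i μ = 1 ∧ μ ≠ π}, χ j.1 (q j) ≠ 0 := fun j hj => hq ⟨j, hj⟩
    -- the momentum of leg `ν` lies in the NEW extended sector, hence not in the old one
    have hνnew : q ⟨ν, hi ν, hνπ⟩ ∈
        extSector D.S D.e D.fr (if ν.val < 2 then jl' else jr') (s ν) := by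
      have h1 : 1 ≤ (if ν.val < 2 then jl' else jr') := by split_ifs <;> assumption
      have hsν : s ν ∈ D.Sig (if ν.val < 2 then jl' else jr') := by
        have := hs ν
        split_ifs at this ⊢ <;> exact this
      exact hD.chi_support _ h1 _ hsν (hq' ⟨ν, hi ν, hνπ⟩)
    have hνold : q ⟨ν, hi ν, hνπ⟩ ∉ extSector D.S D.e D.fr (if ν.val < 2 then jl else jr) (s' ν) := by
      intro hB
      have : q ⟨ν, hi ν, hνπ⟩ ∈ extSector D.S D.e D.fr (if ν.val < 2 then jl' else jr') (s ν) ∩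
          extSector D.S D.e D.fr (if ν.val < 2 then jl else jr) (s' ν) := ⟨hνnew, hB⟩
      rw [hν] at this
      exact this
    -- complete `q` to a configuration on the conservation surface
    set k : Fin 4 → SpT := fun μ => if h' : i μ = 1 ∧ μ ≠ π then q ⟨μ, h'⟩ else
      -(((-1 : ℝ) ^ bExp π) • ∑ j : {μ : Fin 4 // i μ = 1 ∧ μ ≠ π}, ((-1 : ℝ) ^ bExp j.1) • q j)
      with hkdef
    have hk : k 0 - k 1 - k 2 + k 3 = 0 := surface_of_legFill hi π q
    have hkj : ∀ j : {μ : Fin 4 // i μ = 1 ∧ μ ≠ π}, k j.1 = q j := by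
      intro j
      show (if h' : i j.1 = 1 ∧ j.1 ≠ π then q ⟨j.1, h'⟩ else _) = _
      rw [dif_pos j.2]
    have hkν : k ν ∉ extSector D.S D.e D.fr (if ν.val < 2 then jl else jr) (s' ν) := by
      rw [hkj ⟨ν, hi ν, hνπ⟩]; exact hνold
    have hint' : ∀ π₀ : Fin 4, Integrable fun u : {μ : Fin 4 // i μ = 1 ∧ μ ≠ π₀} → SpT =>
        f i (fun μ => if h' : i μ = 1 ∧ μ ≠ π₀ then u ⟨μ, h'⟩ else if μ = π₀ then 0 else k μ) s' := by
      intro π₀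
      have := hint π₀
      simp_rw [legFill_congr hi π₀ 0 k₀ k] at this
      exact this
    have hzero := pinFT_eq_zero_of_not_mem_extSector D.S D.e D.fr hi hsec htr s' k hk π hint' hkν
    have hG' : ∀ u : {μ : Fin 4 // i μ = 1 ∧ μ ≠ π} → SpT,
        (∏ j : {μ : Fin 4 // i μ = 1 ∧ μ ≠ π},
            Complex.exp (Complex.I * ((σ j.1 : ℝ) : ℂ) * (mink (q j) (u j) : ℂ))) * G u =
          (∏ μ : {μ : Fin 4 // i μ = 1 ∧ μ ≠ π}, legPhase μ.1 (k μ.1) (u μ)) *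
            f i (fun μ => if h' : i μ = 1 ∧ μ ≠ π then u ⟨μ, h'⟩ else if μ = π then 0 else k μ)
              s' := by
      intro u
      rw [hGdef, hFdef]
      beta_reduce
      rw [legFill_congr hi π 0 k₀ k]
      congr 1
      refine Finset.prod_congr rfl fun j _ => ?_
      rw [legPhase, hkj j, hσdef]
      push_cast
      ring_nf
    simp_rw [hG']
    rw [hzero, mul_zero]
  -- Step 4: split off the position of leg `π` and conclude
  haveI := isAddRightInvariant_volume_pi_SpT (κ := {μ : Fin 4 // i μ = 1 ∧ μ ≠ π})
  have hinner : ∀ τ : SpT, ∫ u : {μ : Fin 4 // i μ = 1 ∧ μ ≠ π} → SpT, Θ (Φ (τ, u)) = 0 := by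
    intro τ
    set H : ({μ : Fin 4 // i μ = 1 ∧ μ ≠ π} → SpT) → ℂ := fun v =>
      (∏ j : {μ : Fin 4 // i μ = 1 ∧ μ ≠ π}, chiHat (χ j.1) (σ j.1 • ((y j.1 - τ) - v j))) * G v
      with hHdef
    have hfun : (fun u : {μ : Fin 4 // i μ = 1 ∧ μ ≠ π} → SpT => Θ (Φ (τ, u))) =
        fun u => chiHat (χ π) (σ π • (y π - τ)) *
          H (u - fun _ : {μ : Fin 4 // i μ = 1 ∧ μ ≠ π} => τ) := by
      funext u; rw [hΘΦ τ u]
    have hH0 : ∫ v, H v = 0 := by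
      rw [hHdef]
      exact integral_prod_chiHat_mul_eq_zero (fun j : {μ : Fin 4 // i μ = 1 ∧ μ ≠ π} => χ j.1)
        (fun j => σ j.1) G hG (fun j => hχ j.1) HC (fun j => y j.1 - τ)
    rw [hfun, integral_const_mul,
      integral_sub_right_eq_self H (fun _ : {μ : Fin 4 // i μ = 1 ∧ μ ≠ π} => τ), hH0, mul_zero]
  show ∫ x', Θ x' = 0
  rw [← hΦmp.integral_comp' Θ]
  by_cases hΘi : Integrable (fun z : SpT × ({μ : Fin 4 // i μ = 1 ∧ μ ≠ π} → SpT) => Θ (Φ z))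
      ((volume : Measure SpT).prod volume)
  · calc ∫ z, Θ (Φ z) = ∫ z, Θ (Φ z) ∂((volume : Measure SpT).prod volume) := rfl
      _ = ∫ τ : SpT, ∫ u : {μ : Fin 4 // i μ = 1 ∧ μ ≠ π} → SpT, Θ (Φ (τ, u)) :=
          integral_prod _ hΘi
      _ = 0 := by simp [hinner]
  · calc ∫ z, Θ (Φ z) = ∫ z, Θ (Φ z) ∂((volume : Measure SpT).prod volume) := rfl
      _ = 0 := integral_undef hΘi

/-- **The support input of `resectScaledNormMax_zero_le_of_support` for the printed case.**  In the
case the paper treats explicitly ("`i₁ = i₂ = i₃ = i₄ = 1` and `ℓ' < ℓ`, `r' < r`", p.13 L43–44: all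
four legs are position legs and both sides change scale) the `s'`-summand `resectTerm` of the
resectorisation vanishes identically as soon as one leg's new and old extended sectors are disjoint,
for `f` sectorized and translation invariant with integrable pinned slices (`legIns`, pinned at `0`;
supplied by `integrable_slice_of_scaledNormMax_ne_top` when the old norm is finite and the component is
measurable). [cite: FeldmanKnorrerTrubowitz2004Ladders, Lemma II.16, proof (p.13 L43–53)] -/
theorem resectTerm_eq_zero_of_extSector_disjoint (D : LadderData) (hD : D.Admissible)
    {jl jr jl' jr' : ℕ} (h1l : 1 ≤ jl') (h1r : 1 ≤ jr') (hjl : jl' ≠ jl) (hjr : jr' ≠ jr)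
    {i : LegKind} (hi : ∀ μ, i μ = 1) {f : FourLegFn} (hsec : IsSectorized D.S D.e D.fr jl jr f)
    (htr : IsTranslationInvariant f) (s s' : Fin 4 → Arc)
    (hs : ∀ μ : Fin 4, s μ ∈ (if μ.val < 2 then D.Sig jl' else D.Sig jr')) (k₀ : Fin 4 → SpT)
    (hint : ∀ π : Fin 4, Integrable fun u : {μ : Fin 4 // i μ = 1 ∧ μ ≠ π} → SpT =>
      f i (legIns i k₀ π 0 u) s')
    {ν : Fin 4} (hν : extSector D.S D.e D.fr (if ν.val < 2 then jl' else jr') (s ν) ∩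
        extSector D.S D.e D.fr (if ν.val < 2 then jl else jr) (s' ν) = ∅) (y : Fin 4 → SpT) :
    resectTerm D jl jr jl' jr' f i s s' y = 0 := by
  have hchg : ∀ μ : Fin 4, i μ = 1 ∧ ((μ.val < 2 ∧ jl' ≠ jl) ∨ (2 ≤ μ.val ∧ jr' ≠ jr)) := by
    intro μ
    refine ⟨hi μ, ?_⟩
    by_cases hμ : μ.val < 2
    · exact Or.inl ⟨hμ, hjl⟩
    · exact Or.inr ⟨by omega, hjr⟩
  exact integral_resect_eq_zero_of_extSector_disjoint D hD h1l h1r hi hsec htr s s' hs k₀ hint hν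
    (fun μ : Fin 4 => i μ = 1 ∧ ((μ.val < 2 ∧ jl' ≠ jl) ∨ (2 ≤ μ.val ∧ jr' ≠ jr))) hchg y

end FKTLadders

end Literature.MathematicalPhysics.QuantumLattice.FermiRG
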